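/-
COR-CM (cell pub-hodgecm2) — Δ2 BRIDGE RE-KEY (coordinator 22:0xZ, branch (c-S.1) «re-key the dictionary at ῑ₁»; ASSEMBLER DECISION #16′
namespace-priming): THE Ω-SLOT (group (b) of `PinSignatures.thm418C_liuDictionaryPin_of_pins`) AT THE PRIMED PIN — the landed Ω-pin packaging
(`CorCM/D2Bridge/OmegaPinAtLiuIndex[OfRecord].lean`, ✔ p371944 ∕ p372105) with the ONE token that the re-key flips in its binder TYPES:
the guard `hi : SplitLine.PhiMuLine ι₁ (line i)` becomes `hi : SplitLine.PhiMuLine ((starRingEnd ℂ).comp ι₁) (line i)` («ῑ₁ ∈ Φ^δ(a_i)», Liu's τ′ =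
the uniformising embedding).  No proof reads `hi`, so every proof is the landed one BY NAME (`OmegaPin.exists_pinTerms_line`, `line_s_eq_chiSplittingLine_iff`,
`update_toFun_line`, pin-3's `exists_weightOne_line_s_eq_chiSplittingLine_toHeckeCharacter`); the index of record `I V (repAt a₀) (muLiu ι₁ rep)`, its
lines, the rests of record, `V`, `hemb` and the Ω transport are NOT re-keyed (REKEY-FLIPSITES §2.1 ∕ §2.4).  Seat prover-pub-hodgecm2-d2bridge-prove-7-g0-0,
2026-08-23.  THEOREMS ONLY, explicit binders; nothing landed is edited or restated.  HC_CM is NOT proved; «Δ2 BRIDGE CLOSED» is NOT claimed.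
-/
import Summits.HodgeConjecture.CorCM.D2Bridge.OmegaPinAtLiuIndexOfRecord
import HarnessLib

/-!
# Ω-pin at δ′ — the key of record and the packaged Ω-slot AT THE PRIMED PIN (`PhiMu′ i := ῑ₁ ∈ (line i).lineType`)

Twins (same names, namespace `HodgeCM.Model.LiuIndex.OmegaPin.Rekey`) of `OmegaPin.exists_pinTerms`, `exists_pinTerms_update`, `key_indexOfRecord`,
`exists_pinTerms_indexOfRecord` with the guard keyed at `ῑ₁ := (starRingEnd ℂ).comp ι₁` — the binder shape of
`Summit.HodgeConjecture.CorCM.D2Bridge.Rekey.PinSignatures.thm418C_liuDictionaryPin_of_pins` (`CorCM/Rekey/D2Bridge/PinSignatures.lean`) group (b).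
The X3-Char character of a continuous index line still has CM type `(line i).lineType` (T-SIGN = MIRROR, ✔ `OmegaPinTSignIndex`); what the re-key
changes is WHICH lines are good (`ῑ₁ ∈ Φ_{μ_i}`, Liu's printed side condition at the uniformising embedding), not the Ω transport.
HC_CM is NOT proved.
-/

set_option autoImplicit false

noncomputable section

open scoped TensorProduct Matrix

namespace HodgeCM.Model.LiuIndex.OmegaPin.Rekey

open NumberField NumberField.InfinitePlace IsDedekindDomain
open Literature.AlgebraicGeometry.Motives
open Literature.AlgebraicGeometry.ShimuraVarieties
open Literature.AlgebraicGeometry.ShimuraVarieties.UnitaryCanonicalModel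
open Literature.NumberTheory.Automorphic
open Literature.NumberTheory.Automorphic.IdeleClassGroup
open Literature.NumberTheory.Automorphic.Liu2021
open Literature.NumberTheory.Automorphic.Liu2021.AppendixC
open Literature.NumberTheory.Automorphic.Liu2021.Def411WeilCarriers (JW TW locF Rep Eps)
open Literature.NumberTheory.Automorphic.Liu2021.Def411WeilCarriersDoubling
open Literature.NumberTheory.GelbartRogawski1991 Literature.NumberTheory.GelbartRogawski1991.UnitaryDualPair
open Literature.RepresentationTheory.Liu2021 (isOscillatorChar_toHeckeCharacter_iff)
open Summit.HodgeConjecture.CorCM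
open Summit.HodgeConjecture.CorCM.Transposition.OmegaTransport (realUnit)
open Summit.HodgeConjecture.CorCM.Transposition.CentralTypeAtPin (exists_weightOne_line_s_eq_chiSplittingLine_toHeckeCharacter)
open HodgeCM.Model.ArchSideTerm (e₁)

/-! ## §1 Packaging over a general index `(ρ, μ₀)`, guard at `ῑ₁` -/

section General

variable {L : HodgeCM.CMField} {ι₁ : (L : Type) →+* ℂ} (V : HodgeCM.HermSpace3 L ι₁)
  (ρ : GramClass L → RealScalar L) (μ₀ : GramClass L → InfinitePlace (L : Type) → ℤ)

/-- **THE Ω-SLOT OF THE PINNED DICTIONARY, PACKAGED, GUARD AT ῑ₁** (twin of `OmegaPin.exists_pinTerms`) in the binder shape `∀ (i) (hi : PhiMuLine ι₁ (line i)) (hg : Good i)` of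
`PinSignatures.thm418C_ofTower_of_pins`: for any goodness predicate with a KEY at every good line — a conjugate-symplectic weight-one `μ` with
`Φ_μ = (line i).lineType` and `(line i).s = ι_{toHecke μ}` (at the index of record: pin-3's X3-Char theorem for the continuous lines) —
sections `r i hi hg` through the lines of record (`hr`) and rests `R i hi hg μ hμ hw` identified with the δ′ rests (`hR`), there are families
`μ ∕ hμ ∕ hw` and `σ ∕ e` over `R i hi hg (μ i hi hg) …` with `hσ`, `he` and the CM-type identity (`hadm` seam).  `exists_pinTerms_line` at every
good line; `Classical.choice` inside the proof only.  HC_CM is NOT proved; «Δ2 BRIDGE CLOSED» is NOT claimed.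
[cite: Liu2021, Thm. 4.18 (FJcycle.tex l. 2232–2237), Def. 4.11 (l. 2088–2096), Def. 4.12 (l. 2102–2108), App. D §D.1 Steps 1–3 (l. 5215–5221)]
[cite: GelbartRogawski1991, §3.1 Prop. 3.1.1 p. 455 L1–3] -/
theorem exists_pinTerms
    (ιV : ↥V.adelicFin →*
      ↥(UnitaryGroup.finAdelic (↥(maximalRealSubfield (L : Type))) (L : Type) (IsCMField.complexConj (L : Type)) 3
        (Matrix.diagonal (frameD V))))
    (h : exists_recordSystem) [IsGalois ℚ (L : Type)] (h6 : 6 ≤ Module.finrank ℚ (L : Type)) (Φ : CMType (L : Type))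
    (Good : I V ρ μ₀ → Prop)
    (key : ∀ i : I V ρ μ₀, SplitLine.PhiMuLine ((starRingEnd ℂ).comp ι₁) (line V ρ μ₀ i) → Good i →
      ∃ (μ : Literature.NumberTheory.Automorphic.IdeleClassGroup (L : Type) →ₜ* Circle) (hμ : IsConjugateSymplectic (L : Type) μ),
        HasWeight (L : Type) μ 1 ∧ HasCMType (L : Type) μ (line V ρ μ₀ i).lineType ∧
          (line V ρ μ₀ i).s =
            chiSplittingLine (L : Type) e₁ (frameD V) (frameD_real V) (frameD_ne V) (toHeckeCharacter (L : Type) μ)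
              (isUnitary_toHeckeCharacter (L : Type) μ) ((isOscillatorChar_toHeckeCharacter_iff μ).mpr hμ)
              (realDiagonal (L : Type) (RealScalar.vec (ρ i.1)) (RealScalar.vec_real (ρ i.1)))
              (isUnit_det_realDiagonal (L : Type) (RealScalar.vec (ρ i.1)) (RealScalar.vec_real (ρ i.1)) (RealScalar.vec_ne (ρ i.1)))
              (Matrix.diagonal (RealScalar.vec (ρ i.1)))
              (realDiagonal_map (L : Type) (RealScalar.vec (ρ i.1)) (RealScalar.vec_real (ρ i.1))).symm)
    (r : ∀ i : I V ρ μ₀, SplitLine.PhiMuLine ((starRingEnd ℂ).comp ι₁) (line V ρ μ₀ i) → Good i → Rep ↥(maximalRealSubfield (L : Type)) (imagUnitSq (L : Type)))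
    (hr : ∀ (i : I V ρ μ₀) (hi : SplitLine.PhiMuLine ((starRingEnd ℂ).comp ι₁) (line V ρ μ₀ i)) (hg : Good i),
      (r i hi hg).toFun (locF ↥(maximalRealSubfield (L : Type)) (imagUnitSq (L : Type)) (realUnit ⟨L.K⟩ (ρ i.1).1 (ρ i.1).2.1 (ρ i.1).2.2)) =
        realUnit ⟨L.K⟩ (ρ i.1).1 (ρ i.1).2.1 (ρ i.1).2.2)
    (R : ∀ (i : I V ρ μ₀) (_ : SplitLine.PhiMuLine ((starRingEnd ℂ).comp ι₁) (line V ρ μ₀ i)) (_ : Good i)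
      (μ : Literature.NumberTheory.Automorphic.IdeleClassGroup (L : Type) →ₜ* Circle) (_ : IsConjugateSymplectic (L : Type) μ)
      (_ : HasWeight (L : Type) μ 1),
      Thm418Rest (Model.sec42DataOf h Model.isoOf ⟨L.K⟩ ι₁ ⟨V.Hm, V.isHermitian, V.signature_ι₁, V.posDef_of_ne⟩ Φ))
    (hR : ∀ (i : I V ρ μ₀) (hi : SplitLine.PhiMuLine ((starRingEnd ℂ).comp ι₁) (line V ρ μ₀ i)) (hg : Good i)
      (μ : Literature.NumberTheory.Automorphic.IdeleClassGroup (L : Type) →ₜ* Circle) (hμ : IsConjugateSymplectic (L : Type) μ)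
      (hw : HasWeight (L : Type) μ 1),
      Model.restOfCharDeltaPrime h ⟨L.K⟩ h6 ι₁ ⟨V.Hm, V.isHermitian, V.signature_ι₁, V.posDef_of_ne⟩ Φ e₁ (frameD V) (frameD_real V)
        (frameD_ne V) ιV (r i hi hg) μ hμ hw = R i hi hg μ hμ hw) :
    ∃ (μ : ∀ i : I V ρ μ₀, SplitLine.PhiMuLine ((starRingEnd ℂ).comp ι₁) (line V ρ μ₀ i) → Good i →
        (Literature.NumberTheory.Automorphic.IdeleClassGroup (L : Type) →ₜ* Circle))
      (hμ : ∀ (i : I V ρ μ₀) (hi : SplitLine.PhiMuLine ((starRingEnd ℂ).comp ι₁) (line V ρ μ₀ i)) (hg : Good i), IsConjugateSymplectic (L : Type) (μ i hi hg))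
      (hw : ∀ (i : I V ρ μ₀) (hi : SplitLine.PhiMuLine ((starRingEnd ℂ).comp ι₁) (line V ρ μ₀ i)) (hg : Good i), HasWeight (L : Type) (μ i hi hg) 1)
      (σ : ∀ (i : I V ρ μ₀) (hi : SplitLine.PhiMuLine ((starRingEnd ℂ).comp ι₁) (line V ρ μ₀ i)) (hg : Good i),
        {χ : (line V ρ μ₀ i).CharW // (line V ρ μ₀ i).IsAutChar χ} →
          (toThm418Data _ (R i hi hg (μ i hi hg) (hμ i hi hg) (hw i hi hg))).AdmIndex)
      (e : ∀ (i : I V ρ μ₀) (hi : SplitLine.PhiMuLine ((starRingEnd ℂ).comp ι₁) (line V ρ μ₀ i)) (hg : Good i)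
        (a : {χ : (line V ρ μ₀ i).CharW // (line V ρ μ₀ i).IsAutChar χ}),
        (line V ρ μ₀ i).Ω ιV a.1 ≃ₗ[ℂ] (toThm418Data _ (R i hi hg (μ i hi hg) (hμ i hi hg) (hw i hi hg))).omegaAt (σ i hi hg a)),
      (∀ (i : I V ρ μ₀) (hi : SplitLine.PhiMuLine ((starRingEnd ℂ).comp ι₁) (line V ρ μ₀ i)) (hg : Good i),
          HasCMType (L : Type) (μ i hi hg) (line V ρ μ₀ i).lineType) ∧
      (∀ (i : I V ρ μ₀) (hi : SplitLine.PhiMuLine ((starRingEnd ℂ).comp ι₁) (line V ρ μ₀ i)) (hg : Good i), Function.Injective (σ i hi hg)) ∧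
      (∀ (i : I V ρ μ₀) (hi : SplitLine.PhiMuLine ((starRingEnd ℂ).comp ι₁) (line V ρ μ₀ i)) (hg : Good i)
          (a : {χ : (line V ρ μ₀ i).CharW // (line V ρ μ₀ i).IsAutChar χ}) (g : ↥V.adelicFin) (m : (line V ρ μ₀ i).Ω ιV a.1),
          e i hi hg a (MonoidAlgebra.of ℂ ↥V.adelicFin g • m) =
            (toThm418Data _ (R i hi hg (μ i hi hg) (hμ i hi hg) (hw i hi hg))).rhoAt (σ i hi hg a) g (e i hi hg a m)) := by
  choose μ hμ hw hΦ hs using key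
  have H := fun (i : I V ρ μ₀) (hi : SplitLine.PhiMuLine ((starRingEnd ℂ).comp ι₁) (line V ρ μ₀ i)) (hg : Good i) =>
    exists_pinTerms_line V ρ μ₀ ιV h h6 Φ i (r i hi hg) (hr i hi hg) (μ i hi hg) (hμ i hi hg) (hw i hi hg) _
      (hR i hi hg (μ i hi hg) (hμ i hi hg) (hw i hi hg)) (hΦ i hi hg)
      ((line_s_eq_chiSplittingLine_iff V ρ μ₀ i (μ i hi hg) (hμ i hi hg)).1 (hs i hi hg))
  choose σ hσ e he using H
  exact ⟨μ, hμ, hw, σ, e, hΦ, hσ, he⟩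

/-- **THE Ω-SLOT AT DECISION #9's SECTIONS, GUARD AT ῑ₁** (twin of `OmegaPin.exists_pinTerms_update`) `r i := Rep.update Rep.ofLineOf (locF u_{a_i}) u_{a_i} rfl` (= F5's `repOfLine a_i`):
`exists_pinTerms` with `hr := Rep.update_toFun_self`; the identified rests are then the composition's per-line `(U i hi hg).rest (tail …)` at
the constant section, by `hR`. [cite: Liu2021, Thm. 4.18 (FJcycle.tex l. 2232–2237), Def. 4.12 (l. 2102–2108)] -/
theorem exists_pinTerms_update
    (ιV : ↥V.adelicFin →*
      ↥(UnitaryGroup.finAdelic (↥(maximalRealSubfield (L : Type))) (L : Type) (IsCMField.complexConj (L : Type)) 3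
        (Matrix.diagonal (frameD V))))
    (h : exists_recordSystem) [IsGalois ℚ (L : Type)] (h6 : 6 ≤ Module.finrank ℚ (L : Type)) (Φ : CMType (L : Type))
    (Good : I V ρ μ₀ → Prop)
    (key : ∀ i : I V ρ μ₀, SplitLine.PhiMuLine ((starRingEnd ℂ).comp ι₁) (line V ρ μ₀ i) → Good i →
      ∃ (μ : Literature.NumberTheory.Automorphic.IdeleClassGroup (L : Type) →ₜ* Circle) (hμ : IsConjugateSymplectic (L : Type) μ),
        HasWeight (L : Type) μ 1 ∧ HasCMType (L : Type) μ (line V ρ μ₀ i).lineType ∧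
          (line V ρ μ₀ i).s =
            chiSplittingLine (L : Type) e₁ (frameD V) (frameD_real V) (frameD_ne V) (toHeckeCharacter (L : Type) μ)
              (isUnitary_toHeckeCharacter (L : Type) μ) ((isOscillatorChar_toHeckeCharacter_iff μ).mpr hμ)
              (realDiagonal (L : Type) (RealScalar.vec (ρ i.1)) (RealScalar.vec_real (ρ i.1)))
              (isUnit_det_realDiagonal (L : Type) (RealScalar.vec (ρ i.1)) (RealScalar.vec_real (ρ i.1)) (RealScalar.vec_ne (ρ i.1)))
              (Matrix.diagonal (RealScalar.vec (ρ i.1)))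
              (realDiagonal_map (L : Type) (RealScalar.vec (ρ i.1)) (RealScalar.vec_real (ρ i.1))).symm)
    (R : ∀ (i : I V ρ μ₀) (_ : SplitLine.PhiMuLine ((starRingEnd ℂ).comp ι₁) (line V ρ μ₀ i)) (_ : Good i)
      (μ : Literature.NumberTheory.Automorphic.IdeleClassGroup (L : Type) →ₜ* Circle) (_ : IsConjugateSymplectic (L : Type) μ)
      (_ : HasWeight (L : Type) μ 1),
      Thm418Rest (Model.sec42DataOf h Model.isoOf ⟨L.K⟩ ι₁ ⟨V.Hm, V.isHermitian, V.signature_ι₁, V.posDef_of_ne⟩ Φ))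
    (hR : ∀ (i : I V ρ μ₀) (hi : SplitLine.PhiMuLine ((starRingEnd ℂ).comp ι₁) (line V ρ μ₀ i)) (hg : Good i)
      (μ : Literature.NumberTheory.Automorphic.IdeleClassGroup (L : Type) →ₜ* Circle) (hμ : IsConjugateSymplectic (L : Type) μ)
      (hw : HasWeight (L : Type) μ 1),
      Model.restOfCharDeltaPrime h ⟨L.K⟩ h6 ι₁ ⟨V.Hm, V.isHermitian, V.signature_ι₁, V.posDef_of_ne⟩ Φ e₁ (frameD V) (frameD_real V)
        (frameD_ne V) ιV
        (Rep.update ↥(maximalRealSubfield (L : Type)) (imagUnitSq (L : Type))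
          (Rep.ofLineOf ↥(maximalRealSubfield (L : Type)) (imagUnitSq (L : Type)))
          (locF ↥(maximalRealSubfield (L : Type)) (imagUnitSq (L : Type)) (realUnit ⟨L.K⟩ (ρ i.1).1 (ρ i.1).2.1 (ρ i.1).2.2))
          (realUnit ⟨L.K⟩ (ρ i.1).1 (ρ i.1).2.1 (ρ i.1).2.2) rfl)
        μ hμ hw = R i hi hg μ hμ hw) :
    ∃ (μ : ∀ i : I V ρ μ₀, SplitLine.PhiMuLine ((starRingEnd ℂ).comp ι₁) (line V ρ μ₀ i) → Good i →
        (Literature.NumberTheory.Automorphic.IdeleClassGroup (L : Type) →ₜ* Circle))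
      (hμ : ∀ (i : I V ρ μ₀) (hi : SplitLine.PhiMuLine ((starRingEnd ℂ).comp ι₁) (line V ρ μ₀ i)) (hg : Good i), IsConjugateSymplectic (L : Type) (μ i hi hg))
      (hw : ∀ (i : I V ρ μ₀) (hi : SplitLine.PhiMuLine ((starRingEnd ℂ).comp ι₁) (line V ρ μ₀ i)) (hg : Good i), HasWeight (L : Type) (μ i hi hg) 1)
      (σ : ∀ (i : I V ρ μ₀) (hi : SplitLine.PhiMuLine ((starRingEnd ℂ).comp ι₁) (line V ρ μ₀ i)) (hg : Good i),
        {χ : (line V ρ μ₀ i).CharW // (line V ρ μ₀ i).IsAutChar χ} →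
          (toThm418Data _ (R i hi hg (μ i hi hg) (hμ i hi hg) (hw i hi hg))).AdmIndex)
      (e : ∀ (i : I V ρ μ₀) (hi : SplitLine.PhiMuLine ((starRingEnd ℂ).comp ι₁) (line V ρ μ₀ i)) (hg : Good i)
        (a : {χ : (line V ρ μ₀ i).CharW // (line V ρ μ₀ i).IsAutChar χ}),
        (line V ρ μ₀ i).Ω ιV a.1 ≃ₗ[ℂ] (toThm418Data _ (R i hi hg (μ i hi hg) (hμ i hi hg) (hw i hi hg))).omegaAt (σ i hi hg a)),
      (∀ (i : I V ρ μ₀) (hi : SplitLine.PhiMuLine ((starRingEnd ℂ).comp ι₁) (line V ρ μ₀ i)) (hg : Good i),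
          HasCMType (L : Type) (μ i hi hg) (line V ρ μ₀ i).lineType) ∧
      (∀ (i : I V ρ μ₀) (hi : SplitLine.PhiMuLine ((starRingEnd ℂ).comp ι₁) (line V ρ μ₀ i)) (hg : Good i), Function.Injective (σ i hi hg)) ∧
      (∀ (i : I V ρ μ₀) (hi : SplitLine.PhiMuLine ((starRingEnd ℂ).comp ι₁) (line V ρ μ₀ i)) (hg : Good i)
          (a : {χ : (line V ρ μ₀ i).CharW // (line V ρ μ₀ i).IsAutChar χ}) (g : ↥V.adelicFin) (m : (line V ρ μ₀ i).Ω ιV a.1),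
          e i hi hg a (MonoidAlgebra.of ℂ ↥V.adelicFin g • m) =
            (toThm418Data _ (R i hi hg (μ i hi hg) (hμ i hi hg) (hw i hi hg))).rhoAt (σ i hi hg a) g (e i hi hg a m)) :=
  exists_pinTerms V ρ μ₀ ιV h h6 Φ Good key
    (fun i _ _ => Rep.update ↥(maximalRealSubfield (L : Type)) (imagUnitSq (L : Type))
      (Rep.ofLineOf ↥(maximalRealSubfield (L : Type)) (imagUnitSq (L : Type)))
      (locF ↥(maximalRealSubfield (L : Type)) (imagUnitSq (L : Type)) (realUnit ⟨L.K⟩ (ρ i.1).1 (ρ i.1).2.1 (ρ i.1).2.2))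
      (realUnit ⟨L.K⟩ (ρ i.1).1 (ρ i.1).2.1 (ρ i.1).2.2) rfl)
    (fun i _ _ => update_toFun_line V ρ μ₀ i) R hR

end General

/-! ## §2 The key of record and the Ω-slot at the PRIMED pinned dictionary of record -/

section OfRecord

variable {L : HodgeCM.CMField} {ι₁ : (L : Type) →+* ℂ} (V : HodgeCM.HermSpace3 L ι₁) (a₀ : RealScalar L)

/-- **THE KEY OF RECORD, GUARD AT ῑ₁** (twin of `OmegaPin.key_indexOfRecord`; the guard is not read) — at `ρ := repAt a₀`, `μ₀ := muLiu ι₁ GramClass.rep`, under `hemb`, every CONTINUOUS index line `i` of the pinned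
dictionary of record has a conjugate-symplectic WEIGHT-ONE `μ` with `Φ_μ = (line i).lineType` and `(line i).s = ι_{toHecke μ}`: pin-3's
X3-Char theorem `exists_weightOne_line_s_eq_chiSplittingLine_toHeckeCharacter` at the two sections of `GramClass.mk` (`repAt_spec a₀`,
`GramClass.mk_rep`), in the spelling of `OmegaPin.exists_pinTerms`'s `key` (the third argument of `chiSplittingLine` is a proof).
[cite: Liu2021, Def. 4.1 ∕ 4.3, Def. 4.12 (FJcycle.tex l. 2102–2108), Prop. 4.13 (l. 2113–2119), App. D §D.1 Step 2 (l. 5219)] -/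
theorem key_indexOfRecord (hemb : (InfinitePlace.mk ι₁).embedding = ι₁) (i : I V (repAt a₀) (muLiu ι₁ GramClass.rep))
    (_hi : SplitLine.PhiMuLine ((starRingEnd ℂ).comp ι₁) (line V (repAt a₀) (muLiu ι₁ GramClass.rep) i))
    (hg : Continuous (i.2.1 : SplittingAt V (repAt a₀ i.1))) :
    ∃ (μ : Literature.NumberTheory.Automorphic.IdeleClassGroup (L : Type) →ₜ* Circle) (hμ : IsConjugateSymplectic (L : Type) μ),
      HasWeight (L : Type) μ 1 ∧ HasCMType (L : Type) μ (line V (repAt a₀) (muLiu ι₁ GramClass.rep) i).lineType ∧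
        (line V (repAt a₀) (muLiu ι₁ GramClass.rep) i).s =
          chiSplittingLine (L : Type) e₁ (frameD V) (frameD_real V) (frameD_ne V) (toHeckeCharacter (L : Type) μ)
            (isUnitary_toHeckeCharacter (L : Type) μ) ((isOscillatorChar_toHeckeCharacter_iff μ).mpr hμ)
            (realDiagonal (L : Type) (RealScalar.vec (repAt a₀ i.1)) (RealScalar.vec_real (repAt a₀ i.1)))
            (isUnit_det_realDiagonal (L : Type) (RealScalar.vec (repAt a₀ i.1)) (RealScalar.vec_real (repAt a₀ i.1))
              (RealScalar.vec_ne (repAt a₀ i.1)))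
            (Matrix.diagonal (RealScalar.vec (repAt a₀ i.1)))
            (realDiagonal_map (L : Type) (RealScalar.vec (repAt a₀ i.1)) (RealScalar.vec_real (repAt a₀ i.1))).symm :=
  exists_weightOne_line_s_eq_chiSplittingLine_toHeckeCharacter V (repAt a₀) GramClass.rep (fun q => repAt_spec a₀ q)
    GramClass.mk_rep hemb i hg

/-- **THE Ω-SLOT AT THE PRIMED PINNED DICTIONARY OF RECORD, INHABITED** (twin of `OmegaPin.exists_pinTerms_indexOfRecord`, guard at ῑ₁) (`Good i := Continuous i.2.1`, sections `Rep.update Rep.ofLineOf (locF u_{a_i}) u_{a_i} rfl` (= F5's `repOfLine a_i`), rests the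
composition's `R i hi hg μ hμ hw` identified by `hR` with the δ′ rest at `Rep.update Rep.ofLineOf (locF u_{a_i}) u_{a_i} rfl`): families `μ ∕ hμ ∕ hw` (weight-one characters OF THE LINES, from X3-Char) and
`σ ∕ e` with `hσ`, `he` and the `hadm` seam — `OmegaPin.exists_pinTerms_update` at `key_indexOfRecord`.  These are the binder group (b)
of `PinSignatures.thm418C_ofTower_of_pins` at `Char := I V (repAt a₀) (muLiu ι₁ rep)`, `Adm i := {χ ∕∕ (line i).IsAutChar χ}`, `χof i a := a.1`,
`PhiMu i := PhiMuLine ι₁ (line i)` (the literal `liuDictionaryPin`, `rfl`).  HC_CM is NOT proved; «Δ2 BRIDGE CLOSED» is NOT claimed.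
[cite: Liu2021, Thm. 4.18 (FJcycle.tex l. 2232–2237), Def. 4.11 (l. 2088–2096), Def. 4.12 (l. 2102–2108), Prop. 4.13 (l. 2113–2119), App. D §D.1 Steps 1–3 (l. 5215–5221)]
[cite: GelbartRogawski1991, §3.1 Prop. 3.1.1 p. 455 L1–3] -/
theorem exists_pinTerms_indexOfRecord
    (ιV : ↥V.adelicFin →*
      ↥(UnitaryGroup.finAdelic (↥(maximalRealSubfield (L : Type))) (L : Type) (IsCMField.complexConj (L : Type)) 3
        (Matrix.diagonal (frameD V))))
    (h : exists_recordSystem) [IsGalois ℚ (L : Type)] (h6 : 6 ≤ Module.finrank ℚ (L : Type)) (Φ : CMType (L : Type))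
    (hemb : (InfinitePlace.mk ι₁).embedding = ι₁)
    (R : ∀ (i : I V (repAt a₀) (muLiu ι₁ GramClass.rep))
      (_ : SplitLine.PhiMuLine ((starRingEnd ℂ).comp ι₁) (line V (repAt a₀) (muLiu ι₁ GramClass.rep) i))
      (_ : Continuous (i.2.1 : SplittingAt V (repAt a₀ i.1)))
      (μ : Literature.NumberTheory.Automorphic.IdeleClassGroup (L : Type) →ₜ* Circle) (_ : IsConjugateSymplectic (L : Type) μ)
      (_ : HasWeight (L : Type) μ 1),
      Thm418Rest (Model.sec42DataOf h Model.isoOf ⟨L.K⟩ ι₁ ⟨V.Hm, V.isHermitian, V.signature_ι₁, V.posDef_of_ne⟩ Φ))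
    (hR : ∀ (i : I V (repAt a₀) (muLiu ι₁ GramClass.rep))
      (hi : SplitLine.PhiMuLine ((starRingEnd ℂ).comp ι₁) (line V (repAt a₀) (muLiu ι₁ GramClass.rep) i))
      (hg : Continuous (i.2.1 : SplittingAt V (repAt a₀ i.1)))
      (μ : Literature.NumberTheory.Automorphic.IdeleClassGroup (L : Type) →ₜ* Circle) (hμ : IsConjugateSymplectic (L : Type) μ)
      (hw : HasWeight (L : Type) μ 1),
      Model.restOfCharDeltaPrime h ⟨L.K⟩ h6 ι₁ ⟨V.Hm, V.isHermitian, V.signature_ι₁, V.posDef_of_ne⟩ Φ e₁ (frameD V) (frameD_real V)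
        (frameD_ne V) ιV
        (Rep.update ↥(maximalRealSubfield (L : Type)) (imagUnitSq (L : Type))
          (Rep.ofLineOf ↥(maximalRealSubfield (L : Type)) (imagUnitSq (L : Type)))
          (locF ↥(maximalRealSubfield (L : Type)) (imagUnitSq (L : Type))
            (realUnit ⟨L.K⟩ (repAt a₀ i.1).1 (repAt a₀ i.1).2.1 (repAt a₀ i.1).2.2))
          (realUnit ⟨L.K⟩ (repAt a₀ i.1).1 (repAt a₀ i.1).2.1 (repAt a₀ i.1).2.2) rfl)
        μ hμ hw = R i hi hg μ hμ hw) :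
    ∃ (μ : ∀ i : I V (repAt a₀) (muLiu ι₁ GramClass.rep),
        SplitLine.PhiMuLine ((starRingEnd ℂ).comp ι₁) (line V (repAt a₀) (muLiu ι₁ GramClass.rep) i) → Continuous (i.2.1 : SplittingAt V (repAt a₀ i.1)) →
          (Literature.NumberTheory.Automorphic.IdeleClassGroup (L : Type) →ₜ* Circle))
      (hμ : ∀ (i : I V (repAt a₀) (muLiu ι₁ GramClass.rep))
        (hi : SplitLine.PhiMuLine ((starRingEnd ℂ).comp ι₁) (line V (repAt a₀) (muLiu ι₁ GramClass.rep) i))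
        (hg : Continuous (i.2.1 : SplittingAt V (repAt a₀ i.1))), IsConjugateSymplectic (L : Type) (μ i hi hg))
      (hw : ∀ (i : I V (repAt a₀) (muLiu ι₁ GramClass.rep))
        (hi : SplitLine.PhiMuLine ((starRingEnd ℂ).comp ι₁) (line V (repAt a₀) (muLiu ι₁ GramClass.rep) i))
        (hg : Continuous (i.2.1 : SplittingAt V (repAt a₀ i.1))), HasWeight (L : Type) (μ i hi hg) 1)
      (σ : ∀ (i : I V (repAt a₀) (muLiu ι₁ GramClass.rep))
        (hi : SplitLine.PhiMuLine ((starRingEnd ℂ).comp ι₁) (line V (repAt a₀) (muLiu ι₁ GramClass.rep) i))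
        (hg : Continuous (i.2.1 : SplittingAt V (repAt a₀ i.1))),
        {χ : (line V (repAt a₀) (muLiu ι₁ GramClass.rep) i).CharW // (line V (repAt a₀) (muLiu ι₁ GramClass.rep) i).IsAutChar χ} →
          (toThm418Data _ (R i hi hg (μ i hi hg) (hμ i hi hg) (hw i hi hg))).AdmIndex)
      (e : ∀ (i : I V (repAt a₀) (muLiu ι₁ GramClass.rep))
        (hi : SplitLine.PhiMuLine ((starRingEnd ℂ).comp ι₁) (line V (repAt a₀) (muLiu ι₁ GramClass.rep) i))
        (hg : Continuous (i.2.1 : SplittingAt V (repAt a₀ i.1)))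
        (a : {χ : (line V (repAt a₀) (muLiu ι₁ GramClass.rep) i).CharW //
          (line V (repAt a₀) (muLiu ι₁ GramClass.rep) i).IsAutChar χ}),
        (line V (repAt a₀) (muLiu ι₁ GramClass.rep) i).Ω ιV a.1 ≃ₗ[ℂ]
          (toThm418Data _ (R i hi hg (μ i hi hg) (hμ i hi hg) (hw i hi hg))).omegaAt (σ i hi hg a)),
      (∀ (i : I V (repAt a₀) (muLiu ι₁ GramClass.rep))
          (hi : SplitLine.PhiMuLine ((starRingEnd ℂ).comp ι₁) (line V (repAt a₀) (muLiu ι₁ GramClass.rep) i))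
          (hg : Continuous (i.2.1 : SplittingAt V (repAt a₀ i.1))),
          HasCMType (L : Type) (μ i hi hg) (line V (repAt a₀) (muLiu ι₁ GramClass.rep) i).lineType) ∧
      (∀ (i : I V (repAt a₀) (muLiu ι₁ GramClass.rep))
          (hi : SplitLine.PhiMuLine ((starRingEnd ℂ).comp ι₁) (line V (repAt a₀) (muLiu ι₁ GramClass.rep) i))
          (hg : Continuous (i.2.1 : SplittingAt V (repAt a₀ i.1))), Function.Injective (σ i hi hg)) ∧
      (∀ (i : I V (repAt a₀) (muLiu ι₁ GramClass.rep))
          (hi : SplitLine.PhiMuLine ((starRingEnd ℂ).comp ι₁) (line V (repAt a₀) (muLiu ι₁ GramClass.rep) i))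
          (hg : Continuous (i.2.1 : SplittingAt V (repAt a₀ i.1)))
          (a : {χ : (line V (repAt a₀) (muLiu ι₁ GramClass.rep) i).CharW //
            (line V (repAt a₀) (muLiu ι₁ GramClass.rep) i).IsAutChar χ})
          (g : ↥V.adelicFin) (m : (line V (repAt a₀) (muLiu ι₁ GramClass.rep) i).Ω ιV a.1),
          e i hi hg a (MonoidAlgebra.of ℂ ↥V.adelicFin g • m) =
            (toThm418Data _ (R i hi hg (μ i hi hg) (hμ i hi hg) (hw i hi hg))).rhoAt (σ i hi hg a) g (e i hi hg a m)) :=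
  exists_pinTerms_update V (repAt a₀) (muLiu ι₁ GramClass.rep) ιV h h6 Φ
    (fun i => Continuous (i.2.1 : SplittingAt V (repAt a₀ i.1))) (key_indexOfRecord V a₀ hemb) R hR

end OfRecord

end HodgeCM.Model.LiuIndex.OmegaPin.Rekey

end
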